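/-
COR-CM (cells pub-hodgecm / pub-hodgecm2, stage 2 of the Hodge ladder) — TRANSPOSITION item (vi), S-LANE CARRIERS-PLAN step S7, SECOND
re-cut, ω-PART: the one-object re-cut `Transposition/Item6SupplyPinnedAssemblyAlongHoldsRestOne.lean` (pin-3, S7 first re-cut) with the
theta-side carriers `Eps`/`epsOf`/`Chi`/`omega`/`rho` NO LONGER POSITED but taken to be mc-theta-3's DEFINITIONS
(`Liu2021/Def411WeilCarriers.lean`, CARRIERS-PLAN S2ε + S3: collections mod local norms, automorphic characters of `E¹\(𝔸_E^∞)¹`, the Weil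
`χ`-coinvariants `ω(μ,ε,χ)` of the finite-adelic dual pair `U(V) × U(⟨lineOf ε⟩)` with their `𝔾(𝔸_F^∞)`-action), read at the face datum
through hcomp-level's DIAGONAL FRAME (`HComp/HermSpaceDiagonalFrame.lean`, (m6′): `V ≅ V.diag`, `V.adelicFinDiag : U(V)(𝔸_f) ≃ₜ* U(diag
d)(𝔸_f)`) and the CM lane's constants (`imagUnit`, `realDiagonal`, `GelbartRogawski1991/UnitaryDualPairThetaKernelCM.lean`) — RECIPE
`pub-hodgecm/mc/pub-hodgecm-mc-theta-3-g38/RECIPE-S7-omega.md` c465cd2a97a3 §1–§2 (parametric form, μ-attachment VISIBLE).  EFFECT ON THE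
DISPLAY of the first re-cut: the posited data `Eps`, `epsOf`, `Chi`, `omega` (+2 instance families), `rho` and the hypotheses `hChi`, `hsm`
are GONE (`hChi := Def411WeilCarriers.nonempty_chi`, `hsm := Def411WeilCarriers.rho_smooth` — THEOREMS); IN THEIR PLACE the display carries the
SPLITTING FAMILY of [Liu2021, App. D Step 2] as ONE input: `s` (for every face and every hermitian line `⟨a⟩`, `a ∈ (F⁺)^×`, a splitting
`G₁(𝔸) = U(J_V ⊗ (a))(𝔸) → Mp` of [GR91, Prop. 3.1.1]) with its two printed properties `hs` (compatible) and `hsc` (continuous) — the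
splitting family is thus a DISPLAYED DATUM, not hidden (CARRIERS-PLAN v1.3 §5 row S2ε+S3).  CITE CLASS OF `hLiu` HERE (TGTBT D20 W3, option (γ),
tgtbt-1 g20; cite-1 DELTA 22 (1)): `hLiu` asks [Liu2021] Thm. 4.18 for the oscillator `ω_s(μ, ε, χ)` OF THE DISPLAYED FAMILY `s` — it is the
PRINTED `ω(μ, ε, χ)` (App. D Step 2, l. 5217) IFF `s` is the splitting attached to `μ` (`s_ε|U(V) = ι_μ`); NO binder of this file asserts that
μ-link, and for another compatible `s` the two oscillators differ by a twist `ν ∘ det_V` ([HKS96 §1]; `Def411WeilCarriers` §GR docstring).  So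
the class is «Thm. 4.18 for the `s`-oscillator; = as printed under the μ-link», to be carried in CARRIERS-PLAN row 6 / §5 — NOT «as printed»
unconditionally.  pin-3 =
prover-pub-hodgecm2-pin-3-g3-0 (S7 owner).  Theorems only; nothing landed is edited or restated (NEW path, FILE-ONCE).  FRAMING: HC_CM is NOT
proved; S2 = B01-S is NOT inhabited; NOT claimed: that `s` is Liu's splitting or that `ω` so built is irreducible (`hirr` stays a
hypothesis — [Liu2021] Lem. D.1 (1), to be cited as `LemD1AsPrinted`); `iso`, `C`, `P`, `s`, `rhoΩ` are POSITED.  RED-TEAM WATCHES carried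
from the first re-cut (TGTBT D18.3 item 1; cite-1 g22): `P` is a FREE token family (at a `P` inhabited on pairs without the printed
`(λ_μ, r_μ)` the object type may exceed `𝒜(μ)` and `hLiu`/`hObj` read «+ l. 1982 ([Shi71] Thm. 5)»); `rhoΩ` is a POSITED `𝔾(𝔸_F^∞)`-action on
`Ω(μ)` (it equals the printed Hecke action of l. 2219 only under S6/(U7), `AppendixC/RestOneHecke`), so `hLiu`'s main clause is asked at
that posited action.  ALTERNATIVE INPUT for `(s, hs, hsc)` (s2crux-idea-1 ROUTES §16 / s2crux-idea-2 `HGR-LineBridge`): the GR91-by-doubling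
lane already in the tree supplies, from stage 1's cited `hGRU`, a compatible continuous splitting family of exactly this type by `splittingOf`
— ANY compatible family instantiates this END; matching Liu's printed `ω(μ, ε, χ)` (App. D Step 2) is the separate cite-class question.
-/
import Summits.HodgeConjecture.CorCM.B01.Transposition.Item6SupplyPinnedAssemblyAlongHoldsRestOne
import Summits.HodgeConjecture.CorCM.B01.Transposition.HComp.HermSpaceDiagonalFrame
import Literature.NumberTheory.Automorphic.Liu2021.Def411WeilCarriers
import Literature.NumberTheory.GelbartRogawski1991.UnitaryDualPairThetaKernelCM
import HarnessLib

set_option autoImplicit false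

/-!
# B01-S and the (β)-free END display at `R := restOne … (μ := μ(Φ, ι₁))` with the ω-carriers of `Def411WeilCarriers` — S7, second re-cut (ω)

Instantiation (RECIPE §1): Liu's `F` := `F⁺ = maximalRealSubfield F`, `E` := `F`, `c` := `IsCMField.complexConj F`, `N` := 3,
`e` := `finProdFinEquiv : Fin 3 × Fin 1 ≃ Fin (3·1)`; `δ` := `imagUnit F` (`hcδ` := `complexConj_imagUnit`, `hδ` := `imagUnit_ne_zero`,
`d` := `imagUnitSq F`, `hd` := `imagUnit_mul_self`); `T_V` := `realDiagonal F V.diagEntries _`, `J_V` := `Matrix.diagonal V.diagEntries`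
(`hJV` := `realDiagonal_map …|>.symm`, `hV` := `realDiagonal_isSymm`, `hVd` := `isUnit_det_realDiagonal … V.diagEntries_ne_zero`);
`ι` := `V.adelicFinDiag.toMulEquiv.toMonoidHom : U(V)(𝔸_f) →* U(diag V.diagEntries)(𝔸_f)` (continuous: `V.continuous_adelicFinDiag_toMonoidHom`).
Terms (RECIPE §2): `Eps := Def411WeilCarriers.Eps F⁺ (imagUnitSq F)`, `epsOf := epsOf F⁺ (imagUnitSq F) F (imagUnit F)` (`e ↦` classes of
`½·Tr(e/δ)`), `Chi := Chi F⁺ F c̄`, `omega := omega F⁺ F c̄ 3 e J_V … (hs …)`, `rho := rho … (hs …) ι`; `hChi := nonempty_chi`,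
`hsm := rho_smooth … ι hι (hsc …)`.  KERNEL: one application of `faceSupply_of_thm418AsPrinted_along_conj_holds_restOne` (first re-cut).
HC_CM is NOT proved.

References: Y. Liu, arXiv:2102.11518 = Camb. J. Math. 9 (2021) (`FJcycle.tex` md5 6db49a74122d): Def. 4.11–4.12 l. 2083–2108, Def. 4.16–Rem.
4.17 l. 2219–2227, Thm. 4.18 l. 2232–2245, App. D §D.1 Steps 1–3 l. 5215–5223, Lem. D.1.  S. Gelbart, J. Rogawski, *L-functions and
Fourier–Jacobi coefficients for the unitary group U(3)*, Invent. Math. 105 (1991) §3.1 Prop. 3.1.1.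
-/

noncomputable section

open scoped TensorProduct InnerProductSpace Kronecker

namespace Summit.HodgeConjecture.CorCM.Model

open CategoryTheory CategoryTheory.Limits AlgebraicGeometry NumberField
open Literature.AlgebraicGeometry.Motives
open Literature.AlgebraicGeometry.HodgeTheory
open Literature.AlgebraicGeometry.ShimuraVarieties
open Literature.AlgebraicGeometry.ShimuraVarieties.UnitaryCanonicalModel
open Literature.NumberTheory.ComplexMultiplication
open Literature.NumberTheory.Automorphic
open Literature.NumberTheory.Automorphic.IdeleClassGroup
open Literature.NumberTheory.Automorphic.PicardCM
open Literature.NumberTheory.Automorphic.Liu2021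
open Literature.NumberTheory.Automorphic.Liu2021.AppendixC
open Literature.NumberTheory.Automorphic.Liu2021.AppendixC.RestOne
open Literature.NumberTheory.Automorphic.Liu2021.Def411WeilCarriers (JW TW isSymm_TW isUnit_det_TW JW_eq)
open Literature.NumberTheory.GelbartRogawski1991 Literature.NumberTheory.GelbartRogawski1991.UnitaryDualPair
open Literature.NumberTheory.Weil1964 Literature.RepresentationTheory
open Summit.HodgeConjecture.CorCM.Transposition

/-! ## §1  B01-S at the one-object rest with the Weil-coinvariant ω-carriers -/

/-- **B01-S from [Liu 2021, Thm. 4.18] READ at the one-object rest of the chosen character WITH `ω_s(μ,ε,χ)` := the Weil `χ`-coinvariants of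
the finite-adelic unitary dual pair `U(V) × U(⟨lineOf ε⟩)`** (Def. 4.11, App. D §D.1 Steps 1–3; mc-theta-3's `Def411WeilCarriers`, read at the
face through hcomp-level's diagonal frame): the first re-cut `faceSupply_of_thm418AsPrinted_along_conj_holds_restOne` at
`Eps := Def411WeilCarriers.Eps F⁺ δ²`, `epsOf := epsOf F⁺ δ² F δ`, `Chi := Chi F⁺ F c̄`, `omega := omega … (hs …)`, `rho := rho … (hs …) ι`
(`ι := V.adelicFinDiag`), with `hChi := nonempty_chi` and `hsm := rho_smooth` THEOREMS.  Displayed hypotheses: cites `h`, `hA`; posited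
`iso`, `C` (§4.2 / App. C), `P` (Def. 4.5 (2) bullets 3–4, token), THE SPLITTING FAMILY `s` with `hs` (compatible, [GR91] Prop. 3.1.1) and `hsc`
(continuous) — a DATUM standing for «the splitting attached to `μ`» of App. D Step 2 (l. 5217), whose μ-link `s_ε|U(V) = ι_μ` is NOT asserted
by any binder —, `rhoΩ` (POSITED `𝔾(𝔸_F^∞)`-action on `Ω(μ)`; = the printed Hecke action of l. 2219 only under S6); THE CITE `hLiu` (Thm. 4.18 READ
at this rest: for the `s`-oscillator `ω_s(μ,ε,χ)` — the printed `ω(μ,ε,χ)` iff the μ-link holds (TGTBT D20 W3 (γ)); main clause at the posited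
`rhoΩ`; on the OBJECT quantifier of item (1) ≤ print — one chosen object —; at a free `P` «+ l. 1982»); `hObj` = Prop. 4.6 (1) verbatim over `Def45.CMDatum … (Carriers.ofPolDR …)`; `hirr`
(Def. 4.11 «irreducible» = Lem. D.1 (1), to be cited).  HC_CM is NOT proved; none of the hypotheses is inhabited here.
[cite: Liu2021, Thm. 4.18 (FJcycle.tex l. 2232–2245), Prop. 4.6 (1) (l. 1969), Def. 4.11–4.12 (l. 2083–2108), App. D §D.1 Steps 1–3 (l. 5215–5223), Def. 4.16–Rem. 4.17 (l. 2219–2227), §4.2 l. 2053–2074 and Prop. C.5 (l. 4627–4637)]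
[cite: GelbartRogawski1991, §3.1 Prop. 3.1.1 p. 455 L1–3] [cite: Deligne1979ShimuraVarieties, §2.1.2 and 2.2.5] -/
theorem faceSupply_of_thm418AsPrinted_along_conj_holds_restOne_omega
    (hHD : exists_isReal_hodgeModel) (hI : hodgePQ_independent_of_hodgeModel)
    (h₁ : BallQuotientUniformised) (h₃ : CMAbelianVarietyRealised)
    (h : exists_recordSystem) (hA : albanese_baseChange_isLimit_fan_jacobian)
    (iso : ∀ (F : CMField) (ι₁ : F →+* ℂ) (_ : HermSpace3 F ι₁) (_ : CMType F), ℕ → Prop)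
    (C : ∀ (F : CMField) (ι₁ : F →+* ℂ) (V : HermSpace3 F ι₁) (Φ : CMType F), Sec42Data (honestP5Of h F ι₁ V Φ) (iso F ι₁ V Φ))
    (P : ∀ (F : CMField) [IsGalois ℚ F] (ι₁ : F →+* ℂ) (_ : HermSpace3 F ι₁) (Φ : CMType F) (A : AbelianVariety F),
      (muAlgValueField F (muOfInvType ι₁ Φ) →+* A.endAlgebra) → Type)
    (s : ∀ (F : CMField) (ι₁ : F →+* ℂ) (V : HermSpace3 F ι₁) (_ : CMType F) (a : (↥(maximalRealSubfield F))ˣ),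
      UnitaryGroup.adelicPair ↥(maximalRealSubfield F) F (IsCMField.complexConj F) 3 1 (Matrix.diagonal V.diagEntries) (JW ↥(maximalRealSubfield F) F a) →*
        adelicMpCont ↥(maximalRealSubfield F) (Fin (3 * 1)) (adelicGram ↥(maximalRealSubfield F) finProdFinEquiv (realDiagonal F V.diagEntries V.complexConj_diagEntries) (TW ↥(maximalRealSubfield F) a)))
    (hs : ∀ (F : CMField) (ι₁ : F →+* ℂ) (V : HermSpace3 F ι₁) (Φ : CMType F) (a : (↥(maximalRealSubfield F))ˣ),
      (splittingDatum ↥(maximalRealSubfield F) F (IsCMField.complexConj F) 3 1 finProdFinEquiv (Matrix.diagonal V.diagEntries) (JW ↥(maximalRealSubfield F) F a) (complexConj_imagUnit F) (imagUnit_ne_zero F) (imagUnit_mul_self F) (realDiagonal_isSymm F V.diagEntries V.complexConj_diagEntries) (isSymm_TW ↥(maximalRealSubfield F) a) (isUnit_det_realDiagonal F V.diagEntries V.complexConj_diagEntries V.diagEntries_ne_zero) (isUnit_det_TW ↥(maximalRealSubfield F) a) (realDiagonal_map F V.diagEntries V.complexConj_diagEntries).symm (JW_eq ↥(maximalRealSubfield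 F) F a)).IsCompatible (s F ι₁ V Φ a))
    (hsc : ∀ (F : CMField) (ι₁ : F →+* ℂ) (V : HermSpace3 F ι₁) (Φ : CMType F) (a : (↥(maximalRealSubfield F))ˣ),
      Continuous (pairSplitting ↥(maximalRealSubfield F) F (IsCMField.complexConj F) 3 1 finProdFinEquiv (Matrix.diagonal V.diagEntries) (JW ↥(maximalRealSubfield F) F a) (s F ι₁ V Φ a)))
    (rhoΩ : ∀ (F : CMField) [IsGalois ℚ F] (ι₁ : F →+* ℂ) (V : HermSpace3 F ι₁) (Φ : CMType F),
      Representation (fieldOfValues F (muOfInvType ι₁ Φ)) (C F ι₁ V Φ).G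
        (ΩOne (C F ι₁ V Φ) (AlgHom.id ℚ F) ι₁ (isConjugateSymplectic_muOfInvType ι₁ Φ) (hasWeight_one_muOfInvType ι₁ Φ) (Def45.Carriers.ofPolDR (muOfInvType ι₁ Φ) (P F ι₁ V Φ))))
    (hLiu : ∀ (F : CMField) [IsGalois ℚ F], 6 ≤ Module.finrank ℚ F → ∀ (Φ : CMType F) (ι₁ : F →+* ℂ), ι₁ ∈ Φ.1 →
      ∀ V : HermSpace3 F ι₁, Thm418AsPrintedC (C F ι₁ V Φ)
        (restOne (C F ι₁ V Φ) (AlgHom.id ℚ F) ι₁ (isConjugateSymplectic_muOfInvType ι₁ Φ) (hasWeight_one_muOfInvType ι₁ Φ) (Def45.Carriers.ofPolDR (muOfInvType ι₁ Φ) (P F ι₁ V Φ))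
            (Def411WeilCarriers.Eps ↥(maximalRealSubfield F) (imagUnitSq F)) (Def411WeilCarriers.epsOf ↥(maximalRealSubfield F) (imagUnitSq F) F (imagUnit F)) (Def411WeilCarriers.Chi ↥(maximalRealSubfield F) F (IsCMField.complexConj F))
            (Def411WeilCarriers.omega ↥(maximalRealSubfield F) F (IsCMField.complexConj F) 3 finProdFinEquiv (Matrix.diagonal V.diagEntries) (complexConj_imagUnit F) (imagUnit_ne_zero F) (imagUnit_mul_self F) (realDiagonal_isSymm F V.diagEntries V.complexConj_diagEntries) (isUnit_det_realDiagonal F V.diagEntries V.complexConj_diagEntries V.diagEntries_ne_zero) (realDiagonal_map F V.diagEntries V.complexConj_diagEntries).symm (hs F ι₁ V Φ))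
            (Def411WeilCarriers.rho ↥(maximalRealSubfield F) F (IsCMField.complexConj F) 3 finProdFinEquiv (Matrix.diagonal V.diagEntries) (complexConj_imagUnit F) (imagUnit_ne_zero F) (imagUnit_mul_self F) (realDiagonal_isSymm F V.diagEntries V.complexConj_diagEntries) (isUnit_det_realDiagonal F V.diagEntries V.complexConj_diagEntries V.diagEntries_ne_zero) (realDiagonal_map F V.diagEntries V.complexConj_diagEntries).symm (hs F ι₁ V Φ) V.adelicFinDiag.toMulEquiv.toMonoidHom) (rhoΩ F ι₁ V Φ)))
    (hObj : ∀ (F : CMField) [IsGalois ℚ F], 6 ≤ Module.finrank ℚ F → ∀ (Φ : CMType F) (ι₁ : F →+* ℂ), ι₁ ∈ Φ.1 →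
      ∀ V : HermSpace3 F ι₁,
        Nonempty (Def45.CMDatum (AlgHom.id ℚ F) ι₁ (isConjugateSymplectic_muOfInvType ι₁ Φ) (hasWeight_one_muOfInvType ι₁ Φ) (Def45.Carriers.ofPolDR (muOfInvType ι₁ Φ) (P F ι₁ V Φ))))
    (hirr : ∀ (F : CMField) [IsGalois ℚ F], 6 ≤ Module.finrank ℚ F → ∀ (Φ : CMType F) (ι₁ : F →+* ℂ), ι₁ ∈ Φ.1 →
      ∀ (V : HermSpace3 F ι₁)
        (i : (toThm418Data (C F ι₁ V Φ)
          (restOne (C F ι₁ V Φ) (AlgHom.id ℚ F) ι₁ (isConjugateSymplectic_muOfInvType ι₁ Φ) (hasWeight_one_muOfInvType ι₁ Φ) (Def45.Carriers.ofPolDR (muOfInvType ι₁ Φ) (P F ι₁ V Φ))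
            (Def411WeilCarriers.Eps ↥(maximalRealSubfield F) (imagUnitSq F)) (Def411WeilCarriers.epsOf ↥(maximalRealSubfield F) (imagUnitSq F) F (imagUnit F)) (Def411WeilCarriers.Chi ↥(maximalRealSubfield F) F (IsCMField.complexConj F))
            (Def411WeilCarriers.omega ↥(maximalRealSubfield F) F (IsCMField.complexConj F) 3 finProdFinEquiv (Matrix.diagonal V.diagEntries) (complexConj_imagUnit F) (imagUnit_ne_zero F) (imagUnit_mul_self F) (realDiagonal_isSymm F V.diagEntries V.complexConj_diagEntries) (isUnit_det_realDiagonal F V.diagEntries V.complexConj_diagEntries V.diagEntries_ne_zero) (realDiagonal_map F V.diagEntries V.complexConj_diagEntries).symm (hs F ι₁ V Φ))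
            (Def411WeilCarriers.rho ↥(maximalRealSubfield F) F (IsCMField.complexConj F) 3 finProdFinEquiv (Matrix.diagonal V.diagEntries) (complexConj_imagUnit F) (imagUnit_ne_zero F) (imagUnit_mul_self F) (realDiagonal_isSymm F V.diagEntries V.complexConj_diagEntries) (isUnit_det_realDiagonal F V.diagEntries V.complexConj_diagEntries V.diagEntries_ne_zero) (realDiagonal_map F V.diagEntries V.complexConj_diagEntries).symm (hs F ι₁ V Φ) V.adelicFinDiag.toMulEquiv.toMonoidHom) (rhoΩ F ι₁ V Φ))).AdmIndex),
        (Def411WeilCarriers.rho ↥(maximalRealSubfield F) F (IsCMField.complexConj F) 3 finProdFinEquiv (Matrix.diagonal V.diagEntries) (complexConj_imagUnit F) (imagUnit_ne_zero F) (imagUnit_mul_self F) (realDiagonal_isSymm F V.diagEntries V.complexConj_diagEntries) (isUnit_det_realDiagonal F V.diagEntries V.complexConj_diagEntries V.diagEntries_ne_zero) (realDiagonal_map F V.diagEntries V.complexConj_diagEntries).symm (hs F ι₁ V Φ) V.adelicFinDiag.toMulEquiv.toMonoidHom i.1.1 i.1.2).IsIrreducible) :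
    (picardCMUniverse hHD hI h₁ h₃).FaceSupply :=
  faceSupply_of_thm418AsPrinted_along_conj_holds_restOne hHD hI h₁ h₃ h hA iso C P
    (fun F _ _ _ => Def411WeilCarriers.Eps ↥(maximalRealSubfield F) (imagUnitSq F))
    (fun F _ _ _ => Def411WeilCarriers.epsOf ↥(maximalRealSubfield F) (imagUnitSq F) F (imagUnit F))
    (fun F _ _ _ => Def411WeilCarriers.Chi ↥(maximalRealSubfield F) F (IsCMField.complexConj F))
    (fun F ι₁ V Φ => Def411WeilCarriers.omega ↥(maximalRealSubfield F) F (IsCMField.complexConj F) 3 finProdFinEquiv (Matrix.diagonal V.diagEntries) (complexConj_imagUnit F) (imagUnit_ne_zero F) (imagUnit_mul_self F) (realDiagonal_isSymm F V.diagEntries V.complexConj_diagEntries) (isUnit_det_realDiagonal F V.diagEntries V.complexConj_diagEntries V.diagEntries_ne_zero) (realDiagonal_map F V.diagEntries V.complexConj_diagEntries).symm (hs F ι₁ V Φ))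
    (fun F ι₁ V Φ => Def411WeilCarriers.rho ↥(maximalRealSubfield F) F (IsCMField.complexConj F) 3 finProdFinEquiv (Matrix.diagonal V.diagEntries) (complexConj_imagUnit F) (imagUnit_ne_zero F) (imagUnit_mul_self F) (realDiagonal_isSymm F V.diagEntries V.complexConj_diagEntries) (isUnit_det_realDiagonal F V.diagEntries V.complexConj_diagEntries V.diagEntries_ne_zero) (realDiagonal_map F V.diagEntries V.complexConj_diagEntries).symm (hs F ι₁ V Φ) V.adelicFinDiag.toMulEquiv.toMonoidHom)
    rhoΩ hLiu hObj
    -- a character exists: the trivial one (`Def411WeilCarriers.nonempty_chi`)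
    (fun F _ _ _ _ _ _ => Def411WeilCarriers.nonempty_chi ↥(maximalRealSubfield F) F (IsCMField.complexConj F))
    hirr
    -- «admissible»: smooth vectors, from `WeilCoinv.weilCoinv_comp_smooth` through `Def411WeilCarriers.rho_smooth`, `ι` and the pair
    -- splittings continuous
    (fun F _ _ Φ ι₁ _ V i v =>
      Def411WeilCarriers.rho_smooth ↥(maximalRealSubfield F) F (IsCMField.complexConj F) 3 finProdFinEquiv (Matrix.diagonal V.diagEntries) (complexConj_imagUnit F) (imagUnit_ne_zero F) (imagUnit_mul_self F) (realDiagonal_isSymm F V.diagEntries V.complexConj_diagEntries) (isUnit_det_realDiagonal F V.diagEntries V.complexConj_diagEntries V.diagEntries_ne_zero) (realDiagonal_map F V.diagEntries V.complexConj_diagEntries).symm (hs F ι₁ V Φ)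
        V.adelicFinDiag.toMulEquiv.toMonoidHom V.continuous_adelicFinDiag_toMonoidHom (hsc F ι₁ V Φ) i.1.1 i.1.2 v)

/-! ## §2  THE (β)-FREE END DISPLAY, MEETING FORM, on the universe of record, at the one-object rest with the ω-carriers -/

section MeetingForm

open MeasureTheory
open Prior.Perl34File (Perl34.IsolationSetting)
open Prior.Perl34File.Perl34

/-- **END DISPLAY, (β)-FREE MEETING FORM, on the universe OF RECORD, second re-cut (ω)** (`let U := U_rec`): §1 composed BY NAME with
`hc_cm_of_supply_of_settingMeetSat_embOf` exactly as the first re-cut's §2.  Displayed hypotheses = the §1 binders {`h`, `hA`; `iso`, `C`, `P`, `s`,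
`hs`, `hsc`, `rhoΩ`; `hLiu`, `hObj`, `hirr`} + `hM` (b01-x2's text VERBATIM at `U_rec`).  Compared with the first re-cut: {`Eps`, `epsOf`, `Chi`, `omega`
(+2), `rho`, `hChi`, `hsm`} ↦ {`s`, `hs`, `hsc`}.  HC_CM is NOT proved: no hypothesis is inhabited here.
[cite: Liu2021, Thm. 4.18 (FJcycle.tex l. 2232–2245), Prop. 4.6 (1) (l. 1969), Def. 4.11–4.12 (l. 2083–2108), App. D §D.1 Steps 1–3 (l. 5215–5223), §4.2 l. 2053–2074 and Prop. C.5 (l. 4627–4637)]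
[cite: GelbartRogawski1991, §3.1 Prop. 3.1.1 p. 455 L1–3] [cite: Deligne1979ShimuraVarieties, §2.1.2 and 2.2.5] -/
theorem hc_cm_of_thm418AsPrinted_along_conj_holds_restOne_omega_meeting_rec
    (h : exists_recordSystem) (hA : albanese_baseChange_isLimit_fan_jacobian)
    (iso : ∀ (F : CMField) (ι₁ : F →+* ℂ) (_ : HermSpace3 F ι₁) (_ : CMType F), ℕ → Prop)
    (C : ∀ (F : CMField) (ι₁ : F →+* ℂ) (V : HermSpace3 F ι₁) (Φ : CMType F), Sec42Data (honestP5Of h F ι₁ V Φ) (iso F ι₁ V Φ))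
    (P : ∀ (F : CMField) [IsGalois ℚ F] (ι₁ : F →+* ℂ) (_ : HermSpace3 F ι₁) (Φ : CMType F) (A : AbelianVariety F),
      (muAlgValueField F (muOfInvType ι₁ Φ) →+* A.endAlgebra) → Type)
    (s : ∀ (F : CMField) (ι₁ : F →+* ℂ) (V : HermSpace3 F ι₁) (_ : CMType F) (a : (↥(maximalRealSubfield F))ˣ),
      UnitaryGroup.adelicPair ↥(maximalRealSubfield F) F (IsCMField.complexConj F) 3 1 (Matrix.diagonal V.diagEntries) (JW ↥(maximalRealSubfield F) F a) →*
        adelicMpCont ↥(maximalRealSubfield F) (Fin (3 * 1)) (adelicGram ↥(maximalRealSubfield F) finProdFinEquiv (realDiagonal F V.diagEntries V.complexConj_diagEntries) (TW ↥(maximalRealSubfield F) a)))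
    (hs : ∀ (F : CMField) (ι₁ : F →+* ℂ) (V : HermSpace3 F ι₁) (Φ : CMType F) (a : (↥(maximalRealSubfield F))ˣ),
      (splittingDatum ↥(maximalRealSubfield F) F (IsCMField.complexConj F) 3 1 finProdFinEquiv (Matrix.diagonal V.diagEntries) (JW ↥(maximalRealSubfield F) F a) (complexConj_imagUnit F) (imagUnit_ne_zero F) (imagUnit_mul_self F) (realDiagonal_isSymm F V.diagEntries V.complexConj_diagEntries) (isSymm_TW ↥(maximalRealSubfield F) a) (isUnit_det_realDiagonal F V.diagEntries V.complexConj_diagEntries V.diagEntries_ne_zero) (isUnit_det_TW ↥(maximalRealSubfield F) a) (realDiagonal_map F V.diagEntries V.complexConj_diagEntries).symm (JW_eq ↥(maximalRealSubfield F) F a)).IsCompatible (s F ι₁ V Φ a))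
    (hsc : ∀ (F : CMField) (ι₁ : F →+* ℂ) (V : HermSpace3 F ι₁) (Φ : CMType F) (a : (↥(maximalRealSubfield F))ˣ),
      Continuous (pairSplitting ↥(maximalRealSubfield F) F (IsCMField.complexConj F) 3 1 finProdFinEquiv (Matrix.diagonal V.diagEntries) (JW ↥(maximalRealSubfield F) F a) (s F ι₁ V Φ a)))
    (rhoΩ : ∀ (F : CMField) [IsGalois ℚ F] (ι₁ : F →+* ℂ) (V : HermSpace3 F ι₁) (Φ : CMType F),
      Representation (fieldOfValues F (muOfInvType ι₁ Φ)) (C F ι₁ V Φ).G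
        (ΩOne (C F ι₁ V Φ) (AlgHom.id ℚ F) ι₁ (isConjugateSymplectic_muOfInvType ι₁ Φ) (hasWeight_one_muOfInvType ι₁ Φ) (Def45.Carriers.ofPolDR (muOfInvType ι₁ Φ) (P F ι₁ V Φ))))
    (hLiu : ∀ (F : CMField) [IsGalois ℚ F], 6 ≤ Module.finrank ℚ F → ∀ (Φ : CMType F) (ι₁ : F →+* ℂ), ι₁ ∈ Φ.1 →
      ∀ V : HermSpace3 F ι₁, Thm418AsPrintedC (C F ι₁ V Φ)
        (restOne (C F ι₁ V Φ) (AlgHom.id ℚ F) ι₁ (isConjugateSymplectic_muOfInvType ι₁ Φ) (hasWeight_one_muOfInvType ι₁ Φ) (Def45.Carriers.ofPolDR (muOfInvType ι₁ Φ) (P F ι₁ V Φ))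
            (Def411WeilCarriers.Eps ↥(maximalRealSubfield F) (imagUnitSq F)) (Def411WeilCarriers.epsOf ↥(maximalRealSubfield F) (imagUnitSq F) F (imagUnit F)) (Def411WeilCarriers.Chi ↥(maximalRealSubfield F) F (IsCMField.complexConj F))
            (Def411WeilCarriers.omega ↥(maximalRealSubfield F) F (IsCMField.complexConj F) 3 finProdFinEquiv (Matrix.diagonal V.diagEntries) (complexConj_imagUnit F) (imagUnit_ne_zero F) (imagUnit_mul_self F) (realDiagonal_isSymm F V.diagEntries V.complexConj_diagEntries) (isUnit_det_realDiagonal F V.diagEntries V.complexConj_diagEntries V.diagEntries_ne_zero) (realDiagonal_map F V.diagEntries V.complexConj_diagEntries).symm (hs F ι₁ V Φ))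
            (Def411WeilCarriers.rho ↥(maximalRealSubfield F) F (IsCMField.complexConj F) 3 finProdFinEquiv (Matrix.diagonal V.diagEntries) (complexConj_imagUnit F) (imagUnit_ne_zero F) (imagUnit_mul_self F) (realDiagonal_isSymm F V.diagEntries V.complexConj_diagEntries) (isUnit_det_realDiagonal F V.diagEntries V.complexConj_diagEntries V.diagEntries_ne_zero) (realDiagonal_map F V.diagEntries V.complexConj_diagEntries).symm (hs F ι₁ V Φ) V.adelicFinDiag.toMulEquiv.toMonoidHom) (rhoΩ F ι₁ V Φ)))
    (hObj : ∀ (F : CMField) [IsGalois ℚ F], 6 ≤ Module.finrank ℚ F → ∀ (Φ : CMType F) (ι₁ : F →+* ℂ), ι₁ ∈ Φ.1 →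
      ∀ V : HermSpace3 F ι₁,
        Nonempty (Def45.CMDatum (AlgHom.id ℚ F) ι₁ (isConjugateSymplectic_muOfInvType ι₁ Φ) (hasWeight_one_muOfInvType ι₁ Φ) (Def45.Carriers.ofPolDR (muOfInvType ι₁ Φ) (P F ι₁ V Φ))))
    (hirr : ∀ (F : CMField) [IsGalois ℚ F], 6 ≤ Module.finrank ℚ F → ∀ (Φ : CMType F) (ι₁ : F →+* ℂ), ι₁ ∈ Φ.1 →
      ∀ (V : HermSpace3 F ι₁)
        (i : (toThm418Data (C F ι₁ V Φ)
          (restOne (C F ι₁ V Φ) (AlgHom.id ℚ F) ι₁ (isConjugateSymplectic_muOfInvType ι₁ Φ) (hasWeight_one_muOfInvType ι₁ Φ) (Def45.Carriers.ofPolDR (muOfInvType ι₁ Φ) (P F ι₁ V Φ))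
            (Def411WeilCarriers.Eps ↥(maximalRealSubfield F) (imagUnitSq F)) (Def411WeilCarriers.epsOf ↥(maximalRealSubfield F) (imagUnitSq F) F (imagUnit F)) (Def411WeilCarriers.Chi ↥(maximalRealSubfield F) F (IsCMField.complexConj F))
            (Def411WeilCarriers.omega ↥(maximalRealSubfield F) F (IsCMField.complexConj F) 3 finProdFinEquiv (Matrix.diagonal V.diagEntries) (complexConj_imagUnit F) (imagUnit_ne_zero F) (imagUnit_mul_self F) (realDiagonal_isSymm F V.diagEntries V.complexConj_diagEntries) (isUnit_det_realDiagonal F V.diagEntries V.complexConj_diagEntries V.diagEntries_ne_zero) (realDiagonal_map F V.diagEntries V.complexConj_diagEntries).symm (hs F ι₁ V Φ))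
            (Def411WeilCarriers.rho ↥(maximalRealSubfield F) F (IsCMField.complexConj F) 3 finProdFinEquiv (Matrix.diagonal V.diagEntries) (complexConj_imagUnit F) (imagUnit_ne_zero F) (imagUnit_mul_self F) (realDiagonal_isSymm F V.diagEntries V.complexConj_diagEntries) (isUnit_det_realDiagonal F V.diagEntries V.complexConj_diagEntries V.diagEntries_ne_zero) (realDiagonal_map F V.diagEntries V.complexConj_diagEntries).symm (hs F ι₁ V Φ) V.adelicFinDiag.toMulEquiv.toMonoidHom) (rhoΩ F ι₁ V Φ))).AdmIndex),
        (Def411WeilCarriers.rho ↥(maximalRealSubfield F) F (IsCMField.complexConj F) 3 finProdFinEquiv (Matrix.diagonal V.diagEntries) (complexConj_imagUnit F) (imagUnit_ne_zero F) (imagUnit_mul_self F) (realDiagonal_isSymm F V.diagEntries V.complexConj_diagEntries) (isUnit_det_realDiagonal F V.diagEntries V.complexConj_diagEntries V.diagEntries_ne_zero) (realDiagonal_map F V.diagEntries V.complexConj_diagEntries).symm (hs F ι₁ V Φ) V.adelicFinDiag.toMulEquiv.toMonoidHom i.1.1 i.1.2).IsIrreducible) :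
    let U := picardCMUniverse exists_isReal_hodgeModel_holds hodgePQ_independent_of_hodgeModel_holds
      BallQuotient.ballQuotientUniformised_holds cmAbelianVarietyRealised_holds
    let hU := ballQuotientUniformisedDatum_of BallQuotient.ballQuotientUniformised_holds
    (∀ (F : CMField), IsGalois ℚ F → 6 ≤ Module.finrank ℚ F → ∀ (f : Face F) (ι₁ : F →+* ℂ), f.Admissible ι₁ →
      ∀ V : HermSpace3 F ι₁,
      ∃ (H CG G SK SigIdx SigIdxG : Type) (_ : NormedAddCommGroup H) (_ : InnerProductSpace ℂ H) (_ : CompleteSpace H)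
        (_ : NormedAddCommGroup CG) (_ : NormedSpace ℂ CG) (_ : Group G) (_ : TopologicalSpace G) (_ : TopologicalSpace SK)
        (S : Perl34.IsolationSetting H (Lp ℂ 2 V.autMeasure) CG G SK SigIdx SigIdxG),
        (∀ (Γ : Level V) (ω₁ ω₂ : U.CohC (U.pms F ι₁ V Γ) 1),
          ω₁ ∈ U.Uiso Γ F (f.psi 0) ι₁ → ω₂ ∈ U.Uiso Γ F (f.psi 1) ι₁ →
            embOf exists_isReal_hodgeModel_holds hodgePQ_independent_of_hodgeModel_holds hU cmAbelianVarietyRealised_holds Γ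
                (U.cup2C (U.pms F ι₁ V Γ) 1 ω₁ ω₂) ≠ 0 →
              ∃ u ∈ S.t12.S12,
                ⟪embOf exists_isReal_hodgeModel_holds hodgePQ_independent_of_hodgeModel_holds hU cmAbelianVarietyRealised_holds Γ
                    (U.cup2C (U.pms F ι₁ V Γ) 1 ω₁ ω₂), u⟫_ℂ ≠ 0) ∧
        (∀ χ : S.t34.X, S.t34.allowed χ → ∀ (Φ : SK) (Γ₁ : Level V)
          (ω₁ ω₂ : U.CohC (U.pms F ι₁ V Γ₁) 1),
          ω₁ ∈ U.Uiso Γ₁ F (f.psi 0) ι₁ →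
          ω₂ ∈ U.Uiso Γ₁ F (f.psi 1) ι₁ →
            ⟪embOf exists_isReal_hodgeModel_holds hodgePQ_independent_of_hodgeModel_holds hU cmAbelianVarietyRealised_holds Γ₁
                (U.cup2C (U.pms F ι₁ V Γ₁) 1 ω₁ ω₂),
              S.t34.ϑ χ Φ⟫_ℂ ≠ 0 →
              ∃ (Γ : Level V) (ω : Fin 4 → U.CohC (U.pms F ι₁ V Γ) 1),
                (∀ i, ω i ∈ U.Uiso Γ F (f.psi i) ι₁) ∧
                  ⟪embOf exists_isReal_hodgeModel_holds hodgePQ_independent_of_hodgeModel_holds hU cmAbelianVarietyRealised_holds Γ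
                      (U.cup2C (U.pms F ι₁ V Γ) 1 (ω 2) (ω 3)),
                    embOf exists_isReal_hodgeModel_holds hodgePQ_independent_of_hodgeModel_holds hU cmAbelianVarietyRealised_holds Γ
                      (U.cup2C (U.pms F ι₁ V Γ) 1 (ω 0) (ω 1))⟫_ℂ
                    ≠ 0)) →
    HC_CM :=
  fun hM ↦ hc_cm_of_supply_of_settingMeetSat_embOf exists_isReal_hodgeModel_holds hodgePQ_independent_of_hodgeModel_holds
    BallQuotient.ballQuotientUniformised_holds cmAbelianVarietyRealised_holds deligneMilne1982_Thm_6_20_full_holds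
    (faceSupply_of_thm418AsPrinted_along_conj_holds_restOne_omega _ _ _ _ h hA iso C P s hs hsc rhoΩ hLiu hObj hirr) hM

end MeetingForm

end Summit.HodgeConjecture.CorCM.Model

end
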